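import Mathlib.Combinatorics.SimpleGraph.Connectivity.Connected
import Literature.Probability.Percolation.Percolation
import HarnessLib

/-!
# Finite-graph witness engine, III: kernel-decidable connection events and the exact
# connection-probability evaluator

Topic `Literature/Computation/FiniteGraph`; everything proved, no facts. The finitely refutable
percolation statements of the tree (Kozma–Nitzan-type gluing inequalities, route
`PercNearOneGluing`) live on `Fin n` with the inhomogeneous product measure
`Literature.Probability.LatticeModels.prodBernoulli w` on `Set (Sym2 (Fin n))` and the connection
events `Literature.Probability.Percolation.openConn`. This file is the combinatorial half of their
exact evaluation:

* `cfgOf n op : Set (Sym2 (Fin n))` — the bond configuration of an open-edge list `op` on `ℕ`, and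
  the recursion `reachable_cfgOf_cons_iff` for reachability in its open graph when one edge is
  added (`x ↔ y` iff `x ↔ y` before, or `x ↔ u, v ↔ y`, or `x ↔ v, u ↔ y`);
* component LABELS `lab : List ℕ` maintained by `addEdge` (union by relabelling) with the invariant
  `LabelsOK n op lab` ("equal labels iff reachable", `labelsOK_range_nil`, `LabelsOK.cons`), and
  the target test `joined lab o T` with its correctness `LabelsOK.joined_iff`;
* `connNumZ`, `connDen`, `connProb n E o T ∈ ℚ` — the evaluator of `P(o ↔ T)` for a weighted edge
  list `E = [(u, v, a, b), …]` (edge `{u,v}` open with probability `a/b`): binary recursion over the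
  list (open: factor `a` and merge the two labels, closed: factor `b - a`), with the pruning "`o`
  already joined to `T` ⇒ the whole subtree contributes `∏ b`" (connection is an increasing event).
  Its identification with `(prodBernoulli w).real (⋃ t ∈ T, openConn o t)` is the companion file
  `ReliabilityBridge.lean`.

Design as in parts I–II: structural recursion only, integers inside, one rational division at
the end; cost `O(2^m · n)` in the worst case, much less with pruning; `decide +kernel` handles
`m ≈ 14` edges on `n ≈ 8` vertices in seconds, `native_decide` beyond. [folklore] throughout
(union–find by relabelling; Grimmett 1999, §1.3 for the model).

## References
* G. Grimmett, *Percolation*, 2nd ed., Springer 1999, §1.3 [Grimmett1999].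
-/

namespace Literature.Computation.FiniteGraph

open Literature.Probability.Percolation

/-! ### The configuration of an open-edge list -/

/-- Adjacency along the listed edges, on `ℕ`. [folklore] -/
def ListAdj (op : List (ℕ × ℕ)) (a b : ℕ) : Prop := ∃ p ∈ op, s(a, b) = s(p.1, p.2)

/-- The bond configuration on `Fin n` (set of open `Sym2` edges) encoded by an open-edge list on `ℕ`.
[folklore] -/
def cfgOf (n : ℕ) (op : List (ℕ × ℕ)) : Set (Sym2 (Fin n)) :=
  {e | ∃ p ∈ op, e.map Fin.val = s(p.1, p.2)}

/-- Adjacency in the open graph of `cfgOf n op`. [folklore] -/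
theorem openGraph_cfgOf_adj {n : ℕ} (op : List (ℕ × ℕ)) (x y : Fin n) :
    (openGraph (cfgOf n op)).Adj x y ↔ ListAdj op x y ∧ x ≠ y := by
  rw [openGraph_adj]
  simp [cfgOf, ListAdj]

/-- More open edges, larger open graph. [folklore] -/
theorem openGraph_cfgOf_mono {n : ℕ} {op op' : List (ℕ × ℕ)} (h : ∀ p ∈ op, p ∈ op') :
    openGraph (cfgOf n op) ≤ openGraph (cfgOf n op') := by
  intro x y hxy
  rw [openGraph_cfgOf_adj] at hxy ⊢
  obtain ⟨⟨p, hp, he⟩, hne⟩ := hxy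
  exact ⟨⟨p, h p hp, he⟩, hne⟩

/-- With no open edge, reachability is equality. [folklore] -/
theorem reachable_cfgOf_nil_iff {n : ℕ} (x y : Fin n) : (openGraph (cfgOf n [])).Reachable x y ↔ x = y := by
  constructor
  · rintro ⟨W⟩
    cases W with
    | nil => rfl
    | cons h _ => exact absurd ((openGraph_cfgOf_adj [] _ _).1 h).1 (by simp [ListAdj])
  · rintro rfl
    exact SimpleGraph.Reachable.refl _

/-- **Reachability after opening one more edge `{u, v}`**: `x ↔ y` iff `x ↔ y` already, or
`x ↔ u` and `v ↔ y`, or `x ↔ v` and `u ↔ y` (all in the smaller graph). [folklore] -/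
theorem reachable_cfgOf_cons_iff {n : ℕ} (op : List (ℕ × ℕ)) (u v x y : Fin n) :
    (openGraph (cfgOf n (((u : ℕ), (v : ℕ)) :: op))).Reachable x y ↔
      (openGraph (cfgOf n op)).Reachable x y ∨
      ((openGraph (cfgOf n op)).Reachable x u ∧ (openGraph (cfgOf n op)).Reachable v y) ∨
      ((openGraph (cfgOf n op)).Reachable x v ∧ (openGraph (cfgOf n op)).Reachable u y) := by
  have hle : openGraph (cfgOf n op) ≤ openGraph (cfgOf n (((u : ℕ), (v : ℕ)) :: op)) :=
    openGraph_cfgOf_mono fun p hp => List.mem_cons_of_mem _ hp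
  constructor
  · rintro ⟨W⟩
    induction W with
    | nil => exact Or.inl (SimpleGraph.Reachable.refl _)
    | @cons a b c hadj W ih =>
        obtain ⟨⟨p, hp, he⟩, hab⟩ := (openGraph_cfgOf_adj _ a b).1 hadj
        rcases List.mem_cons.1 hp with rfl | hp'
        · -- the new edge
          have hcases : (a = u ∧ b = v) ∨ (a = v ∧ b = u) := by
            rcases Sym2.eq_iff.1 he with ⟨h1, h2⟩ | ⟨h1, h2⟩
            · exact Or.inl ⟨Fin.ext h1, Fin.ext h2⟩
            · exact Or.inr ⟨Fin.ext h1, Fin.ext h2⟩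
          rcases hcases with ⟨rfl, rfl⟩ | ⟨rfl, rfl⟩
          · rcases ih with h | ⟨_, h2⟩ | ⟨_, h2⟩
            · exact Or.inr (Or.inl ⟨SimpleGraph.Reachable.refl _, h⟩)
            · exact Or.inr (Or.inl ⟨SimpleGraph.Reachable.refl _, h2⟩)
            · exact Or.inl h2
          · rcases ih with h | ⟨_, h2⟩ | ⟨_, h2⟩
            · exact Or.inr (Or.inr ⟨SimpleGraph.Reachable.refl _, h⟩)
            · exact Or.inl h2
            · exact Or.inr (Or.inr ⟨SimpleGraph.Reachable.refl _, h2⟩)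
        · -- an old edge
          have hR : (openGraph (cfgOf n op)).Reachable a b :=
            SimpleGraph.Adj.reachable ((openGraph_cfgOf_adj op a b).2 ⟨⟨p, hp', he⟩, hab⟩)
          rcases ih with h | ⟨h1, h2⟩ | ⟨h1, h2⟩
          · exact Or.inl (hR.trans h)
          · exact Or.inr (Or.inl ⟨hR.trans h1, h2⟩)
          · exact Or.inr (Or.inr ⟨hR.trans h1, h2⟩)
  · have huv : (openGraph (cfgOf n (((u : ℕ), (v : ℕ)) :: op))).Reachable u v := by
      by_cases h : u = v
      · rw [h]
      · exact SimpleGraph.Adj.reachable ((openGraph_cfgOf_adj _ u v).2 ⟨⟨_, List.mem_cons_self, rfl⟩, h⟩)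
    rintro (h | ⟨h1, h2⟩ | ⟨h1, h2⟩)
    · exact h.mono hle
    · exact ((h1.mono hle).trans huv).trans (h2.mono hle)
    · exact ((h1.mono hle).trans huv.symm).trans (h2.mono hle)

/-! ### Component labels (union by relabelling) -/

/-- The label of vertex `x` (default `0`). [folklore] -/
def labelOf (lab : List ℕ) (x : ℕ) : ℕ := lab.getD x 0

/-- Opening the edge `{u, v}`: every vertex labelled like `u` is relabelled like `v`. [folklore] -/
def addEdge (lab : List ℕ) (u v : ℕ) : List ℕ :=
  lab.map fun l => if l = labelOf lab u then labelOf lab v else l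

/-- Some target carries the label of `o`. [folklore] -/
def joined (lab : List ℕ) (o : ℕ) (T : List ℕ) : Bool := T.any fun t => labelOf lab t == labelOf lab o

/-- **The labelling invariant**: the list has one entry per vertex and two vertices carry the same
label iff they are joined in the open graph of the opened edges `op`. [folklore] -/
def LabelsOK (n : ℕ) (op : List (ℕ × ℕ)) (lab : List ℕ) : Prop :=
  lab.length = n ∧ ∀ x y : Fin n, labelOf lab x = labelOf lab y ↔ (openGraph (cfgOf n op)).Reachable x y

/-- Initially (`lab = [0, 1, …, n-1]`, nothing opened) the invariant holds. [folklore] -/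
theorem labelsOK_range_nil (n : ℕ) : LabelsOK n [] (List.range n) := by
  refine ⟨List.length_range, fun x y => ?_⟩
  rw [reachable_cfgOf_nil_iff]
  simp [labelOf, List.getD_eq_getElem?_getD, Fin.ext_iff]

/-- Labels after `addEdge`, entrywise. [folklore] -/
theorem labelOf_addEdge {lab : List ℕ} {x : ℕ} (hx : x < lab.length) (u v : ℕ) :
    labelOf (addEdge lab u v) x = if labelOf lab x = labelOf lab u then labelOf lab v else labelOf lab x := by
  simp only [labelOf, addEdge, List.getD_eq_getElem?_getD, List.getElem?_map]
  rw [List.getElem?_eq_getElem hx]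
  simp

/-- **The invariant is preserved by opening an edge.** [folklore] -/
theorem LabelsOK.cons {n : ℕ} {op : List (ℕ × ℕ)} {lab : List ℕ} (h : LabelsOK n op lab) (u v : Fin n) :
    LabelsOK n (((u : ℕ), (v : ℕ)) :: op) (addEdge lab u v) := by
  obtain ⟨hlen, hiff⟩ := h
  refine ⟨by rw [addEdge, List.length_map, hlen], fun x y => ?_⟩
  rw [reachable_cfgOf_cons_iff, ← hiff x y, ← hiff x u, ← hiff v y, ← hiff x v, ← hiff u y,
    labelOf_addEdge (by rw [hlen]; exact x.2), labelOf_addEdge (by rw [hlen]; exact y.2)]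
  split_ifs <;> omega

/-- **Correctness of the target test** under the invariant. [folklore] -/
theorem LabelsOK.joined_iff {n : ℕ} {op : List (ℕ × ℕ)} {lab : List ℕ} (h : LabelsOK n op lab)
    {o : ℕ} (ho : o < n) (T : List ℕ) (hT : ∀ t ∈ T, t < n) :
    joined lab o T = true ↔ ∃ t, ∃ ht : t ∈ T, (openGraph (cfgOf n op)).Reachable ⟨o, ho⟩ ⟨t, hT t ht⟩ := by
  rw [joined, List.any_eq_true]
  constructor
  · rintro ⟨t, ht, hbeq⟩
    refine ⟨t, ht, ?_⟩
    rw [← h.2 ⟨o, ho⟩ ⟨t, hT t ht⟩]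
    exact (beq_iff_eq.1 hbeq).symm
  · rintro ⟨t, ht, hreach⟩
    refine ⟨t, ht, beq_iff_eq.2 ?_⟩
    exact ((h.2 ⟨o, ho⟩ ⟨t, hT t ht⟩).2 hreach).symm

/-! ### The exact connection-probability evaluator -/

/-- A weighted edge datum `(u, v, a, b)`: the edge `{u, v}` is open with probability `a / b`. [folklore] -/
abbrev PercEdge : Type := ℕ × ℕ × ℕ × ℕ

/-- The common denominator `∏ b`. [folklore] -/
def connDen : List PercEdge → ℕ
  | [] => 1
  | e :: E => e.2.2.2 * connDen E

/-- Integer numerator of `P(o ↔ T)`: binary recursion over the edge list, an open edge `{u,v}`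
contributing the factor `a` and merging the labels of `u` and `v`, a closed one the factor `b - a`;
if `o` is already joined to `T` the subtree is summed in closed form (`∏ b`); at a leaf, the
indicator of `o ↔ T`. [folklore] -/
def connNumZ (o : ℕ) (T : List ℕ) : List PercEdge → List ℕ → ℤ
  | [], lab => if joined lab o T then 1 else 0
  | e :: E, lab => if joined lab o T then ((connDen (e :: E) : ℕ) : ℤ) else
      (e.2.2.1 : ℤ) * connNumZ o T E (addEdge lab e.1 e.2.1) + ((e.2.2.2 : ℤ) - e.2.2.1) * connNumZ o T E lab

/-- **The evaluator**: `connProb n E o T = P(o ↔ T)` for independent edges `E` (the identification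
with `prodBernoulli` is `ReliabilityBridge.prodBernoulli_real_iUnion_openConn_eq`). Kernel example:
the triangle with all weights `1/2`, `P(0 ↔ 1) = p + p² − p³ = 5/8` —
`example : connProb 3 [(0,1,1,2),(1,2,1,2),(0,2,1,2)] 0 [1] = 5/8 := by decide +kernel`. [folklore] -/
def connProb (n : ℕ) (E : List PercEdge) (o : ℕ) (T : List ℕ) : ℚ :=
  (connNumZ o T E (List.range n) : ℚ) / (connDen E : ℚ)

/-- Triangle, all weights `1/2`: `P(0 ↔ 1) = p + p² − p³ = 5/8` at `p = 1/2`. -/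
example : connProb 3 [(0, 1, 1, 2), (1, 2, 1, 2), (0, 2, 1, 2)] 0 [1] = 5 / 8 := by decide +kernel

end Literature.Computation.FiniteGraph
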